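import Literature.NumberTheory.DiophantineGeometry.SymmetricGroupRepsIrreducibleProofs
import Literature.NumberTheory.DiophantineGeometry.TensorPowerCommutant
import Literature.NumberTheory.DiophantineGeometry.SchurWeylCommutantSandwich
import Mathlib.RepresentationTheory.Maschke
import Mathlib.Algebra.CharZero.Infinite
import HarnessLib

/-!
# Weyl modules are irreducible — discharge of `isIrreducible_weylRep`
(trunk ArithGeomL / CplxAlg; Fulton–Harris, Theorem 6.3 (4))

`Literature.NumberTheory.DiophantineGeometry.SchurWeylPlethysm` records as a named fact
(`Literature.CplxAlg.isIrreducible_weylRep : Prop`) that for a field `k` of characteristic zero, a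
finite linearly ordered index type `σ` and a partition `μ ⊢ d` with at most `|σ|` parts, the
Weyl module `S_μ(k^σ) = c_μ · (k^σ)^{⊗d}` (`weylModule k σ μ`, the image of the Young
symmetrizer `c_μ = a_μ b_μ ∈ k[𝔖_d]` acting on the tensor power by permutation of the factors)
with its `GL σ k`-action `weylRep k σ μ` (restriction of `g ↦ g^{⊗d}`, `glTensorRep σ k d`) is an
irreducible representation of `GL σ k`. This file proves it:

* `Literature.CplxAlg.isIrreducible_weylRep_holds : isIrreducible_weylRep k σ`.

Source: W. Fulton, J. Harris, *Representation Theory. A First Course*, GTM 129 (1991), Thm. 6.3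
(4) (PDF p. 118: "Each `𝕊_λ V` is an irreducible representation of `GL(V)`"), proved in §6.2
(PDF p. 127: "Note that `𝕊_λ V` is `U c_λ`, so parts (2) and (4) follow from Lemmas 6.22 and
6.23"). The formal proof follows this architecture exactly (`U = V^{⊗d}`, `A = k[𝔖_d]` acting on
`U` by `permTensorRep`, `B = End_A(U)` its commutant, `c = c_μ`):

* **Lemma 6.23** (second sentence, "A subspace of `V^{⊗d}` is a sub-`B`-module if and only if it
  is invariant by `GL(V)`"; here `apply_mem_of_comm`): a `GL(V)`-stable subspace of `U` is
  stable under every `φ ∈ B`, because `B` is the `k`-span of the operators `g^{⊗d}`,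
  `g ∈ GL(V)`, for `k` infinite — the first sentence of Lemma 6.23, already in the tree as
  `Literature.NumberTheory.DiophantineGeometry.mem_span_glTensorRep_of_comm` (file `TensorPowerCommutant`).
* **Lemma 6.22 (ii)** ("If `W = U c` (`c ∈ A`) then `W` is an irreducible `B`-module", in the
  transitive form extracted from its proof together with Lemma 4.25's mechanism; here
  `exists_comm_apply_eq`): for `w = c u ≠ 0` and any `y = c u'` there is `φ ∈ B` with
  `φ w = y`. This is the tree's `Literature.NumberTheory.DiophantineGeometry.exists_linearMap_apply_smul_eq` (file
  `SchurWeylCommutantSandwich`: `A` a semisimple ring, `U` a semisimple `A`-module, and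
  `c x c ∈ k c` for all `x ∈ A`), fed with Maschke's theorem for `A = k[𝔖_d]` and for the
  `A`-module `U` (Mathlib, `|𝔖_d| = d!` is invertible in characteristic zero) and with the
  sandwich property `c_μ x c_μ ∈ k c_μ` of Lemma 4.23 (2), in the tree as
  `Literature.NumberTheory.DiophantineGeometry.exists_youngSymmetrizer_mul_mul_youngSymmetrizer` (file
  `SymmetricGroupRepsIrreducibleProofs`).
* Hence a nonzero `GL σ k`-subrepresentation `S` of `S_μ(k^σ) = c U` is everything: pick
  `0 ≠ w ∈ S`; every `y ∈ c U` is `φ w` for some `φ ∈ B`, and `φ w ∈ S` as `S` is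
  `GL`-stable. Finally `S_μ(k^σ) ≠ 0` for `μ` with at most `|σ|` parts (Thm. 6.3 (1), in the
  tree as `Literature.NumberTheory.DiophantineGeometry.weylModule_ne_bot_of_card_le`, file `SchurWeylPlethysmProofs`), so the
  lattice of subrepresentations is `{0, S_μ(k^σ)}` with `0 ≠ S_μ(k^σ)`, i.e. `weylRep k σ μ` is
  irreducible (`Representation.IsIrreducible = IsSimpleOrder (Subrepresentation _)`).

Fulton–Harris work over `ℂ`; the argument uses only that `k` is a field of characteristic zero
(Maschke for `𝔖_d`, `2 ≠ 0` in Lemma 4.23, and `k` infinite for the density of `GL(V)` in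
`End(V)`), so the Weyl modules are irreducible over every field of characteristic zero, exactly
as the vendored statement asserts (cf. its second citation, Green, LNM 830, (2.6e) and Thm.
(5.4b): absolute irreducibility over infinite fields).

## References

* W. Fulton, J. Harris, *Representation Theory. A First Course*, GTM 129, Springer (1991),
  doi:10.1007/978-1-4612-0979-9: §6.1 Thm. 6.3 (1), (4) (PDF p. 118); §6.2 Lemma 6.22 (ii),
  Lemma 6.23 and the paragraph following its proof (PDF pp. 126–127); §4.2 Lemma 4.23 (2),
  Lemma 4.25. [FultonHarrisGTM129]
* J. A. Green, *Polynomial Representations of `GL_n`*, LNM 830, Springer (1980), (2.6e), (5.4b)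
  (the statement file's second citation for the fact; not used in the proof). [GreenLNM830]

## Mathlib and tree

Mathlib: Maschke's theorem in the form of the instances
`ComplementedLattice (Submodule (MonoidAlgebra k G) V)` for `[NeZero (Nat.card G : k)]`
(`Mathlib.RepresentationTheory.Maschke`; they give `IsSemisimpleModule (MonoidAlgebra k G) V` and
`IsSemisimpleRing (MonoidAlgebra k G)`), `CharZero.infinite`, `Representation.asModule` /
`asModuleEquiv` (`asModuleEquiv_map_smul`, `asModuleEquiv_symm_map_rho`, `asAlgebraHom_of`),
`LinearMap.restrictScalars`, `Representation.IsIrreducible` (`= IsSimpleOrder (Subrepresentation ρ)`),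
`Subrepresentation.toSubmodule_injective`, `Submodule.exists_mem_ne_zero_of_ne_bot`,
`Submodule.span_induction`. Mathlib has no Schur–Weyl theory. From the tree:
`mem_span_glTensorRep_of_comm` (`TensorPowerCommutant`), `exists_linearMap_apply_smul_eq`
(`SchurWeylCommutantSandwich`), `exists_youngSymmetrizer_mul_mul_youngSymmetrizer`
(`SymmetricGroupRepsIrreducibleProofs`), `weylModule_ne_bot_of_card_le` (`SchurWeylPlethysmProofs`),
`weylModule`, `weylRep`, `glTensorRep`, `permTensorRep`, `youngSymmetrizer` (`SchurWeylPlethysm`,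
`SymmetricGroupReps`). No definitions are introduced.
-/

noncomputable section

open scoped BigOperators TensorProduct

namespace Literature.NumberTheory.DiophantineGeometry

section Irreducibility

variable {k : Type*} [Field k] {σ : Type*} [Fintype σ] {d : ℕ}

/-- **Invariant subspaces** (Fulton–Harris, Lemma 6.23, second sentence, PDF p. 127: "A subspace
of `V^{⊗d}` is a sub-`B`-module if and only if it is invariant by `GL(V)`" — the direction used
for Thm. 6.3): over an infinite field, a `k`-subspace `W` of `(k^σ)^{⊗d}` stable under all
`g^{⊗d}`, `g ∈ GL σ k`, is stable under every endomorphism `φ` commuting with the permutations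
of the factors, since such a `φ` is a `k`-linear combination of the `g^{⊗d}`
(`mem_span_glTensorRep_of_comm`). [cite: FultonHarrisGTM129, Lemma 6.23] -/
theorem apply_mem_of_comm [DecidableEq σ] [Infinite k] {W : Submodule k (TensorPower k d (σ → k))}
    (hW : ∀ (g : GL σ k) {x}, x ∈ W → glTensorRep σ k d g x ∈ W)
    (φ : Module.End k (TensorPower k d (σ → k)))
    (hφ : ∀ τ : Equiv.Perm (Fin d),
      φ ∘ₗ permTensorRep k (σ → k) d τ = permTensorRep k (σ → k) d τ ∘ₗ φ)
    {x : TensorPower k d (σ → k)} (hx : x ∈ W) : φ x ∈ W := by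
  have key : ∀ h ∈ Submodule.span k (Set.range (glTensorRep σ k d)), h x ∈ W := by
    intro h hh
    induction hh using Submodule.span_induction with
    | mem h hh =>
      obtain ⟨g, rfl⟩ := hh
      exact hW g hx
    | zero => exact W.zero_mem
    | add h h' _ _ ih ih' => exact W.add_mem ih ih'
    | smul r h _ ih => exact W.smul_mem r ih
  exact key φ (mem_span_glTensorRep_of_comm φ hφ)

omit [Fintype σ] in
/-- **Transitivity of the `𝔖_d`-commutant on a Weyl module** (Fulton–Harris, Lemma 6.22 (ii)
applied to `U = (k^σ)^{⊗d}`, `A = k[𝔖_d]`, `c = c_μ`, PDF pp. 126–127): in characteristic zero,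
for a nonzero `w ∈ S_μ(k^σ) = c_μ U` and any `y ∈ S_μ(k^σ)` there is a `k`-linear endomorphism
`φ` of `U` commuting with all permutations of the factors and mapping `w` to `y`. Ingredients:
Maschke's theorem (`k[𝔖_d]` is a semisimple ring and `U` a semisimple `k[𝔖_d]`-module,
Mathlib), the sandwich property `c_μ x c_μ ∈ k c_μ`
(`exists_youngSymmetrizer_mul_mul_youngSymmetrizer`, Lemma 4.23 (2)) and
`exists_linearMap_apply_smul_eq` (Lemma 6.22 (ii) with Lemma 4.25's mechanism), transported
along `Representation.asModuleEquiv`. [cite: FultonHarrisGTM129, Lemma 6.22 (ii)] -/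
theorem exists_comm_apply_eq [CharZero k] (μ : Nat.Partition d)
    {w y : TensorPower k d (σ → k)} (hw : w ∈ weylModule k σ μ) (hw0 : w ≠ 0)
    (hy : y ∈ weylModule k σ μ) :
    ∃ φ : Module.End k (TensorPower k d (σ → k)),
      (∀ τ : Equiv.Perm (Fin d),
        φ ∘ₗ permTensorRep k (σ → k) d τ = permTensorRep k (σ → k) d τ ∘ₗ φ) ∧ φ w = y := by
  set ρ := permTensorRep k (σ → k) d with hρ
  set c := youngSymmetrizer k μ with hc_def
  obtain ⟨u, rfl⟩ := hw
  obtain ⟨u', rfl⟩ := hy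
  -- the vectors `u`, `u'` in the `k[𝔖_d]`-module `ρ.asModule`
  set E := ρ.asModuleEquiv with hE
  set x := E.symm u with hx
  set x' := E.symm u' with hx'
  have hcx : E (c • x) = ρ.asAlgebraHom c u := by
    rw [Representation.asModuleEquiv_map_smul, hx, LinearEquiv.apply_symm_apply]
  have hcx' : E (c • x') = ρ.asAlgebraHom c u' := by
    rw [Representation.asModuleEquiv_map_smul, hx', LinearEquiv.apply_symm_apply]
  have hu : c • x ≠ 0 := fun h => hw0 (by rw [← hcx, h, map_zero])
  -- Lemma 6.22 (ii): an `A`-linear endomorphism of `ρ.asModule` with `f (c • x) = c • x'`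
  obtain ⟨f, hf⟩ := exists_linearMap_apply_smul_eq
    (A := MonoidAlgebra k (Equiv.Perm (Fin d))) (M := ρ.asModule)
    (fun z => exists_youngSymmetrizer_mul_mul_youngSymmetrizer (k := k) μ z) hu x'
  -- transported to `U`
  refine ⟨E.toLinearMap ∘ₗ f.restrictScalars k ∘ₗ E.symm.toLinearMap, fun τ => ?_, ?_⟩
  · refine LinearMap.ext fun v => ?_
    simp only [LinearMap.comp_apply, LinearEquiv.coe_coe, LinearMap.restrictScalars_apply]
    rw [Representation.asModuleEquiv_symm_map_rho, map_smul, Representation.asModuleEquiv_map_smul,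
      Representation.asAlgebraHom_of]
  · simp only [LinearMap.comp_apply, LinearEquiv.coe_coe, LinearMap.restrictScalars_apply]
    have h1 : E.symm (ρ.asAlgebraHom c u) = c • x := by rw [LinearEquiv.symm_apply_eq, hcx]
    rw [h1, hf, hcx']

/-- **Weyl modules are irreducible** (Fulton–Harris, *Representation Theory*, Thm. 6.3 (4), PDF
p. 118; proof §6.2, p. 127) — discharge of the named fact `isIrreducible_weylRep`: over a field of
characteristic zero, for `μ ⊢ d` with at most `|σ|` parts, `weylRep k σ μ` on
`S_μ(k^σ) = c_μ · (k^σ)^{⊗d}` is irreducible. Proof: `S_μ(k^σ) ≠ 0`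
(`weylModule_ne_bot_of_card_le`, Thm. 6.3 (1)); if `S` is a nonzero subrepresentation and
`0 ≠ w ∈ S`, then every `y ∈ S_μ(k^σ)` is `φ w` for an endomorphism `φ` of `(k^σ)^{⊗d}`
commuting with `𝔖_d` (`exists_comm_apply_eq`, Lemma 6.22 (ii)), and `φ w ∈ S` because `S` is
`GL σ k`-stable (`apply_mem_of_comm`, Lemma 6.23). [cite: FultonHarrisGTM129, Thm. 6.3 (4)] -/
theorem isIrreducible_weylRep_holds (k σ : Type*) [Field k] [Fintype σ] [LinearOrder σ] :
    isIrreducible_weylRep k σ (d := d) := by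
  intro _ μ hμ
  have hne : weylModule k σ μ ≠ ⊥ := weylModule_ne_bot_of_card_le μ hμ
  haveI : Nontrivial (weylModule k σ μ) := Submodule.nontrivial_iff_ne_bot.mpr hne
  haveI : Nontrivial (Subrepresentation (weylRep k σ μ)) :=
    ⟨⟨⊥, ⊤, fun h => bot_ne_top (congrArg Subrepresentation.toSubmodule h)⟩⟩
  refine ⟨fun S => ?_⟩
  by_cases hS : S = ⊥
  · exact Or.inl hS
  right
  have hS' : S.toSubmodule ≠ ⊥ := fun h =>
    hS (Subrepresentation.toSubmodule_injective (by rw [h]; rfl))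
  obtain ⟨w, hwS, hw0⟩ := Submodule.exists_mem_ne_zero_of_ne_bot hS'
  apply Subrepresentation.toSubmodule_injective
  rw [show (⊤ : Subrepresentation (weylRep k σ μ)).toSubmodule = ⊤ from rfl, eq_top_iff]
  rintro y -
  obtain ⟨φ, hφ, hφy⟩ :=
    exists_comm_apply_eq μ w.2 (fun h => hw0 (Subtype.ext h)) y.2
  -- the image of `S` in `(k^σ)^{⊗d}` is a `GL`-stable subspace, hence stable under `φ`
  set T := S.toSubmodule.map (weylModule k σ μ).subtype with hT
  have hT_stable : ∀ (g : GL σ k) {x}, x ∈ T → glTensorRep σ k d g x ∈ T := by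
    rintro g x ⟨x', hx', rfl⟩
    exact ⟨weylRep k σ μ g x', S.apply_mem_toSubmodule g hx', rfl⟩
  have hyT : (y : TensorPower k d (σ → k)) ∈ T := by
    rw [← hφy]
    exact apply_mem_of_comm hT_stable φ hφ ⟨w, hwS, rfl⟩
  obtain ⟨y', hy', hyy'⟩ := hyT
  rwa [← Subtype.ext hyy']

end Irreducibility

end Literature.NumberTheory.DiophantineGeometry
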